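import Summits.ResolutionOfSingularities.ResolutionOfSingularities.Theorems.EquisingularLiftEquisingularLiftNatNoseUnionCurveClause
import HarnessLib

/-!
# [OURS · L1 W4.5(b) · EL♮(3) · nose residue, N3 (b) file 1/2] LOCAL CLAUSES of a reduced closed subscheme `redSub X Z`:
# generic points on a chart, the stalk ideal of a finite DISJOINT union, and «regular curve» from per-piece ambient data

Crux chain w45b, child EL♮(3) = stmt-ResolutionOfSingularities-20148; WIDTH seat res-L1-w45b-nose-w3 g3 (D-0157 DOOR 1), brick N3 (b) =
clause (b) of res-L1-w45b-nose-w2's «Steiner ∈ ν2» assembly `Steiner.noseHypPointsFirstBTriplePrime_of_clauses` («the reduced nose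
`Z̃′ = redSub F₂ (⋃ i, vertexLineStrict υ i)` is a REGULAR CURVE»). `--supports stmt-ResolutionOfSingularities-20148 --as helper`.
OURS; NOT a statement of any manuscript (nothing of [Hironaka2017] is asserted or used); AI-written, weaker than expert review.
No `sorry`; standard axioms; DEF-FREE. Resolution of singularities in positive characteristic is NOT proved here (dimension 3 is
Cossart–Piltant 2008/2009 in print); EL♮(3) is NOT proved by this file.

WHAT (generic scheme lemmas; `𝓘⟨Z⟩ = vanishingIdeal ⟨Z, _⟩`, `𝓘_x = stalkIdeal`, `redSub X Z = V(𝓘⟨Z⟩)`):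
* `NoseCert.isGenericPoint_of_chart` — for an open immersion `g : Spec D ⟶ X`, a closed IRREDUCIBLE `S ⊆ X` with `g⁻¹S = V(N)`, `N` prime:
  `g(N)` is a generic point of `S` (the generic point of `S` lies in the open `g(Spec D)` since `g(N) ∈ S`; pull the specialisation
  back along the embedding). This is the `hGP` input of the tree's chart lemma
  `CossartJannsenSaito2020.isRegularLocalRing_quotient_stalkIdeal_of_chart_mv`.
* `NoseCert.stalkIdeal_vanishingIdeal_union_eq_left` / `…_iUnion_eq` — off `T`, `𝓘⟨Z ∪ T⟩_x = 𝓘⟨Z⟩_x`; for a finite pairwise disjoint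
  closed family, `𝓘⟨⋃ j, Z j⟩_x = 𝓘⟨Z i⟩_x` at `x ∈ Z i` (`vanishingIdeal_sup`, `stalkIdeal_inf`, `stalkIdeal_eq_top_of_not_mem_support`;
  the pattern of ✓ `NoseCert.ringKrullDim_stalk_redSub_union_eq_left`).
* ★ `NoseCert.redSub_iUnion_regular_and_curve` — «REGULAR CURVE» FOR A FINITE DISJOINT UNION FROM AMBIENT PER-PIECE DATA: if at every
  `x ∈ Z i` the ring `𝒪_{X,x}/𝓘⟨Z i⟩_x` is a regular local ring, of dimension `d` when `x` is closed in `X`, then every local ring of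
  `redSub X (⋃ j, Z j)` is regular and has dimension `d` at its closed points (`𝒪_{V(𝓘),z} ≅ 𝒪_{X,x}/𝓘_x`, tree `nonempty_stalkSubschemeEquiv`).

References (index only): R. Hartshorne, *Algebraic Geometry* (1977), II Ex. 3.2.6, II Prop. 2.5 [cite: Hartshorne1977];
The Stacks Project, Tags 01J3, 0804 [cite: StacksProject]; V. Cossart, U. Jannsen, S. Saito, LNM 2270 (2020), Def. 6.34 (i)
[cite: CossartJannsenSaito2020].
-/

set_option linter.dupNamespace false -- mandated namespace `Summit.<Summit>.<Problem>` of this single-conjunct summit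

noncomputable section

open CategoryTheory AlgebraicGeometry TopologicalSpace Topology
open Literature.AlgebraicGeometry.Resolution
open AlgebraicGeometry.Scheme.IdealSheafData

namespace Summit.ResolutionOfSingularities.ResolutionOfSingularities.Cruxes.EquisingularLiftNat.Sections

namespace NoseCert

/-! ## Generic points seen on a chart -/

/-- **The prime cutting out an irreducible closed set on a chart is its generic point.** For an open immersion `g : Spec D ⟶ X`, a closed
irreducible `S ⊆ X` and a prime `N ⊆ D` with `g w ∈ S ↔ N ≤ w` for all `w`: `g(N)` is a generic point of `S`.
[cite: StacksProject, Tag 0804] (folklore) -/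
theorem isGenericPoint_of_chart {X : Scheme.{0}} {D : CommRingCat.{0}} (g : Spec D ⟶ X) [IsOpenImmersion g]
    {S : Set X} (hS : IsIrreducible S) (hC : IsClosed S) (N : Ideal D) (hN : N.IsPrime)
    (hkey : ∀ w : Spec D, g w ∈ S ↔ N ≤ w.asIdeal) : IsGenericPoint (g ⟨N, hN⟩) S := by
  have hηS : IsGenericPoint hS.genericPoint S := hS.isGenericPoint_genericPoint hC
  have hNS : g ⟨N, hN⟩ ∈ S := (hkey ⟨N, hN⟩).mpr le_rfl
  -- the generic point lies in the open image of `g`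
  have hηU : hS.genericPoint ∈ Set.range g := by
    by_contra hnot
    have h1 : S ⊆ (Set.range g)ᶜ := by
      rw [← hηS.def]
      exact closure_minimal (Set.singleton_subset_iff.mpr hnot) g.isOpenEmbedding.isOpen_range.isClosed_compl
    exact h1 hNS ⟨_, rfl⟩
  obtain ⟨w, hw⟩ := hηU
  have hNw : N ≤ w.asIdeal := (hkey w).mp (hw ▸ hηS.mem)
  -- `g w ⤳ g N` pulls back to `w ⤳ N`, i.e. `w ≤ N`
  have hsp : g w ⤳ g ⟨N, hN⟩ := by
    rw [hw]
    exact hηS.specializes hNS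
  have hsp' : w ⤳ (⟨N, hN⟩ : Spec D) := g.isOpenEmbedding.isInducing.specializes_iff.mp hsp
  have hwN : w.asIdeal ≤ N := (PrimeSpectrum.le_iff_specializes w ⟨N, hN⟩).mpr hsp'
  have hweq : w = ⟨N, hN⟩ := PrimeSpectrum.ext (le_antisymm hwN hNw)
  rw [← hweq, hw]
  exact hηS

/-- Pointwise form of a chart identity `g⁻¹S = V(N)`. [folklore] -/
theorem forall_mem_iff_of_preimage_eq_zeroLocus {X : Scheme.{0}} {D : CommRingCat.{0}} (g : Spec D ⟶ X) {S : Set X}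
    {N : Ideal D} (h : g ⁻¹' S = PrimeSpectrum.zeroLocus (N : Set D)) :
    ∀ w : Spec D, g w ∈ S ↔ N ≤ w.asIdeal := fun w =>
  (Set.ext_iff.mp h w).trans
    ⟨fun hw => SetLike.coe_subset_coe.mp ((PrimeSpectrum.mem_zeroLocus _ _).mp hw),
      fun hw => (PrimeSpectrum.mem_zeroLocus _ _).mpr (SetLike.coe_subset_coe.mpr hw)⟩

/-! ## The stalk ideal of a disjoint union -/

/-- **Off `T`, `𝓘⟨Z ∪ T⟩_x = 𝓘⟨Z⟩_x`** (`𝓘⟨Z ∪ T⟩ = 𝓘⟨Z⟩ ⊓ 𝓘⟨T⟩`, `𝓘⟨T⟩_x = ⊤` for `x ∉ T`). [folklore] -/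
theorem stalkIdeal_vanishingIdeal_union_eq_left {X : Scheme.{0}} {Z T : Set X} (hZ : IsClosed Z) (hT : IsClosed T)
    {x : X} (hx : x ∉ T) :
    stalkIdeal (vanishingIdeal (⟨Z ∪ T, hZ.union hT⟩ : Closeds X)) x = stalkIdeal (vanishingIdeal (⟨Z, hZ⟩ : Closeds X)) x := by
  have hsup : (⟨Z ∪ T, hZ.union hT⟩ : Closeds X) = (⟨Z, hZ⟩ : Closeds X) ⊔ ⟨T, hT⟩ := Closeds.ext rfl
  have hnot : x ∉ (vanishingIdeal (⟨T, hT⟩ : Closeds X)).support := by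
    rw [← SetLike.mem_coe, Scheme.IdealSheafData.coe_support_vanishingIdeal]
    exact hx
  rw [hsup, vanishingIdeal_sup, stalkIdeal_inf, stalkIdeal_eq_top_of_not_mem_support hnot, inf_top_eq]

/-- The stalk ideal `𝓘⟨W⟩_x` only depends on the closed SET `W`. [OURS · bookkeeping] -/
theorem stalkIdeal_vanishingIdeal_congr {X : Scheme.{0}} {W W' : Set X} (hW : IsClosed W) (hW' : IsClosed W') (h : W = W')
    (x : X) : stalkIdeal (vanishingIdeal (⟨W, hW⟩ : Closeds X)) x = stalkIdeal (vanishingIdeal (⟨W', hW'⟩ : Closeds X)) x := by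
  subst h
  rfl

/-- **At a point of `Z i`, the stalk ideal of a finite pairwise DISJOINT closed union `⋃ j, Z j` is that of `Z i`.** [folklore] -/
theorem stalkIdeal_vanishingIdeal_iUnion_eq {X : Scheme.{0}} {ι : Type} [Finite ι] (Z : ι → Set X)
    (hZc : ∀ j, IsClosed (Z j)) (hdisj : Pairwise fun i j => Disjoint (Z i) (Z j)) (hW : IsClosed (⋃ j, Z j))
    {i : ι} {x : X} (hx : x ∈ Z i) :
    stalkIdeal (vanishingIdeal (⟨⋃ j, Z j, hW⟩ : Closeds X)) x = stalkIdeal (vanishingIdeal (⟨Z i, hZc i⟩ : Closeds X)) x := by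
  -- `⋃ j, Z j = Z i ∪ T`, `T = ⋃ j ≠ i, Z j` closed and not containing `x`
  have hT : IsClosed (⋃ j ∈ {j : ι | j ≠ i}, Z j) := (Set.toFinite _).isClosed_biUnion fun j _ => hZc j
  have hxT : x ∉ ⋃ j ∈ {j : ι | j ≠ i}, Z j := by
    intro h
    simp only [Set.mem_iUnion, Set.mem_setOf_eq, exists_prop] at h
    obtain ⟨j, hji, hxj⟩ := h
    exact Set.disjoint_left.mp (hdisj hji) hxj hx
  have hWeq : (⋃ j, Z j) = Z i ∪ ⋃ j ∈ {j : ι | j ≠ i}, Z j := by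
    ext y
    simp only [Set.mem_iUnion, Set.mem_union, Set.mem_setOf_eq, exists_prop]
    constructor
    · rintro ⟨j, hy⟩
      by_cases hji : j = i
      · left; rwa [← hji]
      · right; exact ⟨j, hji, hy⟩
    · rintro (hy | ⟨j, -, hy⟩)
      · exact ⟨i, hy⟩
      · exact ⟨j, hy⟩
  rw [stalkIdeal_vanishingIdeal_congr hW ((hZc i).union hT) hWeq x, stalkIdeal_vanishingIdeal_union_eq_left (hZc i) hT hxT]

/-! ## «Regular curve» for a finite disjoint union, from ambient per-piece data -/

/-- **The local rings of `redSub X W` are the quotients `𝒪_{X,x}/𝓘⟨W⟩_x`**: regularity transfers. [cite: Hartshorne1977, II Ex. 3.2.6]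
(folklore; the ring isomorphism is the tree's `nonempty_stalkSubschemeEquiv`) -/
theorem isRegularLocalRing_stalk_redSub_of_quotient {X : Scheme.{0}} {W : Set X} (hW : IsClosed W) (z : ↥(redSub X W hW))
    (h : IsRegularLocalRing (X.presheaf.stalk (redSubι X W hW z) ⧸ stalkIdeal (vanishingIdeal (⟨W, hW⟩ : Closeds X)) (redSubι X W hW z))) :
    IsRegularLocalRing ((redSub X W hW).presheaf.stalk z) :=
  IsRegularLocalRing.of_ringEquiv (nonempty_stalkSubschemeEquiv (vanishingIdeal (⟨W, hW⟩ : Closeds X)) z).some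

/-- The local dimension of `redSub X W` at `z` is that of `𝒪_{X,x}/𝓘⟨W⟩_x`. [folklore] (tree `ringKrullDim_stalk_subscheme`, restated
in the `redSub` spelling) -/
theorem ringKrullDim_stalk_redSub_eq_quotient {X : Scheme.{0}} {W : Set X} (hW : IsClosed W) (z : ↥(redSub X W hW)) :
    ringKrullDim ((redSub X W hW).presheaf.stalk z) =
      ringKrullDim (X.presheaf.stalk (redSubι X W hW z) ⧸ stalkIdeal (vanishingIdeal (⟨W, hW⟩ : Closeds X)) (redSubι X W hW z)) :=
  ringKrullDim_stalk_subscheme _ z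

/-- ★ **«REGULAR CURVE» FOR A FINITE DISJOINT UNION, FROM AMBIENT PER-PIECE DATA.** Let `Z : ι → Set X` be a finite pairwise disjoint family
of closed sets. If at every point `x ∈ Z i` the quotient `𝒪_{X,x}/𝓘⟨Z i⟩_x` is a regular local ring, and of dimension `d` whenever `x` is a
closed point of `X`, then EVERY local ring of the reduced closed subscheme `redSub X (⋃ j, Z j)` is regular, and those at its closed points
have dimension `d` (the two clauses `hZreg`, `hcurve` of `ReachPtNoseBTriplePrime` for the union). [folklore]
[OURS · L1 W4.5b · EL♮(3) · nose residue N3 (b); NOT a statement of the manuscript] -/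
theorem redSub_iUnion_regular_and_curve {X : Scheme.{0}} {ι : Type} [Finite ι] (Z : ι → Set X) (hZc : ∀ j, IsClosed (Z j))
    (hdisj : Pairwise fun i j => Disjoint (Z i) (Z j)) (hW : IsClosed (⋃ j, Z j)) {d : WithBot ℕ∞}
    (H : ∀ i (x : X), x ∈ Z i →
      IsRegularLocalRing (X.presheaf.stalk x ⧸ stalkIdeal (vanishingIdeal (⟨Z i, hZc i⟩ : Closeds X)) x) ∧
        (IsClosed ({x} : Set X) → ringKrullDim (X.presheaf.stalk x ⧸ stalkIdeal (vanishingIdeal (⟨Z i, hZc i⟩ : Closeds X)) x) = d)) :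
    (∀ z : ↥(redSub X (⋃ j, Z j) hW), IsRegularLocalRing ((redSub X (⋃ j, Z j) hW).presheaf.stalk z)) ∧
      ∀ z : ↥(redSub X (⋃ j, Z j) hW), IsClosed ({z} : Set ↥(redSub X (⋃ j, Z j) hW)) →
        ringKrullDim ((redSub X (⋃ j, Z j) hW).presheaf.stalk z) = d := by
  have key : ∀ z : ↥(redSub X (⋃ j, Z j) hW),
      IsRegularLocalRing (X.presheaf.stalk (redSubι X _ hW z) ⧸ stalkIdeal (vanishingIdeal (⟨⋃ j, Z j, hW⟩ : Closeds X)) (redSubι X _ hW z)) ∧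
        (IsClosed ({(redSubι X _ hW z : X)} : Set X) →
          ringKrullDim (X.presheaf.stalk (redSubι X _ hW z) ⧸
            stalkIdeal (vanishingIdeal (⟨⋃ j, Z j, hW⟩ : Closeds X)) (redSubι X _ hW z)) = d) := by
    intro z
    obtain ⟨i, hi⟩ := Set.mem_iUnion.mp (redSubι_mem z)
    rw [stalkIdeal_vanishingIdeal_iUnion_eq Z hZc hdisj hW hi]
    exact H i _ hi
  refine ⟨fun z => isRegularLocalRing_stalk_redSub_of_quotient hW z (key z).1, fun z hz => ?_⟩
  rw [ringKrullDim_stalk_redSub_eq_quotient hW z]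
  exact (key z).2 (isClosed_image_singleton hz)

end NoseCert

end Summit.ResolutionOfSingularities.ResolutionOfSingularities.Cruxes.EquisingularLiftNat.Sections

end
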